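import Summits.CriticalPhenomena.CardyFormulaZ2.Theorems.CardyBoundaryCoulombGasHalfPlaneMarkDensityLawNearEndLipschitz
import Summits.CriticalPhenomena.CardyFormulaZ2.Theorems.CardyBoundaryCoulombGasHalfPlaneMarkDensityLawDensityUniform

/-!
# `HalfPlaneMarkDensityLaw` (crux stmt-CriticalPhenomena-5661), line `Sketch`:
# joint subsequential limits are differentiable in the INNER marks (lead c4-0)

`P_n(a,b,c,y) = P_{1/2}[[⌊an⌋,⌊bn⌋]×{0} ↔ [⌊cn⌋,⌊yn⌋]×{0} in ℤ×ℕ]`.  Its lattice derivative in the near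
(gap-side) end `b` of the source arc is the near-end first-hit density
`g_n(k) = P[firstHit halfPlane [⌊cn⌋,⌊yn⌋] ⌊an⌋ k]` (`…NearEndLipschitz`), which is `n⁻²`-Lipschitz
uniformly over separated marks.  The pure-analysis files of the line (`…DensityWindow`, `…DensitySubseq`)
apply verbatim to the pair (`b ↦ P_n(a,b,c,y)`, `g_n`):

* `window_sum_eq_b` — exact telescoping in `b` (Russo in the position of the second mark; symmetry of
  `openCrossing` + `measureReal_crossing_window`);
* `uniformRegularity_b` — along every `θ → ∞` on which `P_{θ j}(a,·,c,y)` converges near `b`, the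
  rescaled near-end density converges, the limit is differentiable at `b` with that derivative, second-order
  Taylor bounds and a Lipschitz bound for the limits, constants uniform over `4ε`-separated marks;
* for every joint subsequential limit `G` (c2-0's `exists_jointSubseqLimit`) and chamber point
  `a < b < c < y`: `s ↦ G a s c y` is differentiable at `b` with `∂₂G ≥ 0` the limit along `θ` of
  `n·g_n(⌊bn⌋)` (`hasDerivAt_jointLimit_second`, `deriv_second_nonneg`), and — by the exact lattice
  reflection — `s ↦ G a b s y` is differentiable at `c` with `∂₃G(a,b,c,y) = −∂₂G(−y,−c,−b,−a) ≤ 0`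
  (`hasDerivAt_jointLimit_third`).

With `hasDerivAt_jointLimit` / `hasDerivAt_jointLimit_first` (`…DensityIdentification`): **every joint
subsequential scaling limit of the half-plane four-arc crossing probability of critical bond-`ℤ²` has all
four first partial derivatives at every point of the chamber**, each a (reflected) subsequential scaling
limit of a lattice mark density (registered extra stub `stub_innerMarkDerivatives`).
-/

noncomputable section

namespace Summit.CriticalPhenomena.CardyFormulaZ2.Cruxes.HalfPlaneMarkDensityLaw.SketchLine

open Literature.Probability.Percolation Literature.Probability.LatticeModels
open MeasureTheory Filter Set
open scoped Topology
open Summit.CriticalPhenomena.CardyFormulaZ2.Theorems.HalfPlaneMarkDensityLaw.Negative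

namespace NearEnd

/-! ### Exact telescoping in the second mark -/

/-- `openCrossing` is symmetric in its two arcs. [folklore] -/
theorem openCrossing_comm (S A B : Set (Site 2)) :
    (openCrossing S A B : Set (BondConfig (Site 2))) = openCrossing S B A := by
  ext ω
  constructor
  · rintro ⟨x, hx, y, hy, h⟩
    exact ⟨y, hy, x, hx, SymmDiff.conn_symm h⟩
  · rintro ⟨x, hx, y, hy, h⟩
    exact ⟨y, hy, x, hx, SymmDiff.conn_symm h⟩

/-- **Exact telescoping in `b`** (Russo in the position of the second mark): for `a ≤ s ≤ s'`,
`Σ_{⌊sn⌋ < k ≤ ⌊s'n⌋} P[firstHit halfPlane C_n ⌊an⌋ k] = P_n(a,s',c,y) − P_n(a,s,c,y)`. [folklore] -/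
theorem window_sum_eq_b (a c y : ℝ) {s s' : ℝ} (has : a ≤ s) (hss' : s ≤ s') (n : ℕ) :
    ∑ i ∈ Finset.range (⌊s' * n⌋ - ⌊s * n⌋).toNat,
        μ.real (firstHit halfPlane (rowIcc ⌊c * n⌋ ⌊y * n⌋) ⌊a * n⌋ (⌊s * n⌋ + 1 + i)) =
      μ.real (openCrossing halfPlane (arcA a s' n) (rowIcc ⌊c * n⌋ ⌊y * n⌋)) -
        μ.real (openCrossing halfPlane (arcA a s n) (rowIcc ⌊c * n⌋ ⌊y * n⌋)) := by
  have hk : ⌊a * (n : ℝ)⌋ ≤ ⌊s * (n : ℝ)⌋ + 1 := by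
    have := Int.floor_le_floor (mul_le_mul_of_nonneg_right has (Nat.cast_nonneg n)); omega
  have hM : ((⌊s' * n⌋ - ⌊s * n⌋).toNat : ℤ) = ⌊s' * n⌋ - ⌊s * n⌋ :=
    Int.toNat_of_nonneg (sub_nonneg.2 (Int.floor_le_floor (mul_le_mul_of_nonneg_right hss' (Nat.cast_nonneg n))))
  have h := measureReal_crossing_window halfPlane (rowIcc ⌊c * n⌋ ⌊y * n⌋) hk (⌊s' * n⌋ - ⌊s * n⌋).toNat
  rw [hM, show ⌊s * (n : ℝ)⌋ + (⌊s' * n⌋ - ⌊s * n⌋) = ⌊s' * n⌋ by ring] at h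
  rw [arcA, arcA, ← rowIcc, ← rowIcc, openCrossing_comm halfPlane (rowIcc ⌊a * n⌋ ⌊s' * n⌋),
    openCrossing_comm halfPlane (rowIcc ⌊a * n⌋ ⌊s * n⌋)]
  linarith

/-! ### Uniform regularity of the near-end density along CDF-convergent subsequences -/

/-- **Uniform near-end density regularity.** For every `ε > 0` there is `C ≥ 0` such that for all marks
with `4ε ≤ x₀ − a`, `4ε ≤ c − x₁`, `4ε ≤ y − c`: along every `θ → ∞` on which `P_{θ j}(a,·,c,y)` converges to
`Gs` on a window `(s−δ₀, s+δ₀) ⊆ [x₀,x₁]`, the rescaled near-end density `θ j · g_{θ j}(⌊s θ j⌋)` converges to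
some `ρ`, `Gs'(s) = ρ` with `|Gs(s±t) − Gs(s) ∓ ρt| ≤ Ct²` (`0 < t < δ₀`); and two such limits at
`s, s' ∈ [x₀,x₁]` along the same `θ` satisfy `|ρ' − ρ| ≤ C|s' − s|`. [folklore] -/
theorem uniformRegularity_b {ε : ℝ} (hε : 0 < ε) :
    ∃ C : ℝ, 0 ≤ C ∧ ∀ a c y x₀ x₁ : ℝ, 4 * ε ≤ x₀ - a → 4 * ε ≤ c - x₁ → 4 * ε ≤ y - c →
      (∀ (s δ₀ : ℝ), 0 < δ₀ → x₀ ≤ s - δ₀ → s + δ₀ ≤ x₁ →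
        ∀ θ : ℕ → ℕ, Tendsto θ atTop atTop → ∀ Gs : ℝ → ℝ,
          (∀ s'' : ℝ, s - δ₀ < s'' → s'' < s + δ₀ →
            Tendsto (fun j ↦ μ.real (openCrossing halfPlane (arcA a s'' (θ j))
              (rowIcc ⌊c * (θ j : ℕ)⌋ ⌊y * (θ j : ℕ)⌋))) atTop (𝓝 (Gs s''))) →
          ∃ ρ : ℝ, Tendsto (fun j ↦ (θ j : ℝ) *
              μ.real (firstHit halfPlane (rowIcc ⌊c * (θ j : ℕ)⌋ ⌊y * (θ j : ℕ)⌋) ⌊a * (θ j : ℕ)⌋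
                ⌊s * (θ j : ℕ)⌋)) atTop (𝓝 ρ) ∧ HasDerivAt Gs ρ s ∧
            (∀ t : ℝ, 0 < t → t < δ₀ → |Gs (s + t) - Gs s - ρ * t| ≤ C * t ^ 2) ∧
            (∀ t : ℝ, 0 < t → t < δ₀ → |Gs s - Gs (s - t) - ρ * t| ≤ C * t ^ 2)) ∧
      (∀ θ : ℕ → ℕ, Tendsto θ atTop atTop → ∀ s s' ρ ρ' : ℝ, x₀ ≤ s → s ≤ x₁ → x₀ ≤ s' → s' ≤ x₁ →
        Tendsto (fun j ↦ (θ j : ℝ) *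
            μ.real (firstHit halfPlane (rowIcc ⌊c * (θ j : ℕ)⌋ ⌊y * (θ j : ℕ)⌋) ⌊a * (θ j : ℕ)⌋
              ⌊s * (θ j : ℕ)⌋)) atTop (𝓝 ρ) →
        Tendsto (fun j ↦ (θ j : ℝ) *
            μ.real (firstHit halfPlane (rowIcc ⌊c * (θ j : ℕ)⌋ ⌊y * (θ j : ℕ)⌋) ⌊a * (θ j : ℕ)⌋
              ⌊s' * (θ j : ℕ)⌋)) atTop (𝓝 ρ') →
        |ρ' - ρ| ≤ C * |s' - s|) := by
  obtain ⟨C, hC0, hC⟩ := uniformLipschitz hε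
  refine ⟨C, hC0, fun a c y x₀ x₁ hεxa hεcx hεyc ↦ ⟨fun s δ₀ hδ₀ hlo hhi θ hθ Gs hGs ↦ ?_,
    fun θ hθ s s' ρ ρ' h₀ h₁ h₀' h₁' hρ hρ' ↦ ?_⟩⟩
  · have has : a ≤ s - δ₀ := by linarith
    have hwin : ∀ n : ℕ, ∀ u u' : ℝ, s - δ₀ ≤ u → u ≤ u' → u' ≤ s + δ₀ →
        ∑ i ∈ Finset.range (⌊u' * n⌋ - ⌊u * n⌋).toNat,
            μ.real (firstHit halfPlane (rowIcc ⌊c * n⌋ ⌊y * n⌋) ⌊a * n⌋ (⌊u * n⌋ + 1 + i)) =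
          μ.real (openCrossing halfPlane (arcA a u' n) (rowIcc ⌊c * n⌋ ⌊y * n⌋)) -
            μ.real (openCrossing halfPlane (arcA a u n) (rowIcc ⌊c * n⌋ ⌊y * n⌋)) :=
      fun n u u' hu huu' _ ↦ window_sum_eq_b a c y (has.trans hu) huu' n
    have hlip : ∀ n : ℕ, 1 ≤ n → ∀ k k' : ℤ, ⌊(s - δ₀) * n⌋ ≤ k → k ≤ k' → k' ≤ ⌊(s + δ₀) * n⌋ →
        |μ.real (firstHit halfPlane (rowIcc ⌊c * n⌋ ⌊y * n⌋) ⌊a * n⌋ k') -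
            μ.real (firstHit halfPlane (rowIcc ⌊c * n⌋ ⌊y * n⌋) ⌊a * n⌋ k)| ≤
          C * (k' - k) / (n : ℝ) ^ 2 := by
      intro n hn k k' h1 h2 h3
      have hlo' : ⌊x₀ * (n : ℝ)⌋ ≤ ⌊(s - δ₀) * n⌋ :=
        Int.floor_le_floor (mul_le_mul_of_nonneg_right hlo (Nat.cast_nonneg _))
      have hhi' : ⌊(s + δ₀) * (n : ℝ)⌋ ≤ ⌊x₁ * n⌋ :=
        Int.floor_le_floor (mul_le_mul_of_nonneg_right hhi (Nat.cast_nonneg _))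
      exact hC a c y x₀ x₁ hεxa hεcx hεyc n hn k k' (hlo'.trans h1) h2 (h3.trans hhi')
    obtain ⟨ρ, hρ, hD, hR, hL⟩ := Density.tendsto_pointMass_and_hasDerivAt
      (g := fun n k ↦ μ.real (firstHit halfPlane (rowIcc ⌊c * n⌋ ⌊y * n⌋) ⌊a * n⌋ k))
      (P := fun n u ↦ μ.real (openCrossing halfPlane (arcA a u n) (rowIcc ⌊c * n⌋ ⌊y * n⌋)))
      (G := Gs) (x := s) hC0 hδ₀ hwin hlip hθ hGs
    exact ⟨ρ, hρ, hD, hR, hL⟩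
  · refine Density.abs_sub_le_of_pointMass
      (g := fun n k ↦ μ.real (firstHit halfPlane (rowIcc ⌊c * n⌋ ⌊y * n⌋) ⌊a * n⌋ k)) hθ ?_ hρ hρ'
    filter_upwards [eventually_ge_atTop 1] with n hn
    rcases le_total s s' with hss' | hss'
    · have hfl : ⌊s * (n : ℝ)⌋ ≤ ⌊s' * n⌋ :=
        Int.floor_le_floor (mul_le_mul_of_nonneg_right hss' (Nat.cast_nonneg _))
      have h := hC a c y x₀ x₁ hεxa hεcx hεyc n hn ⌊s * n⌋ ⌊s' * n⌋
        (Int.floor_le_floor (mul_le_mul_of_nonneg_right h₀ (Nat.cast_nonneg _))) hfl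
        (Int.floor_le_floor (mul_le_mul_of_nonneg_right h₁' (Nat.cast_nonneg _)))
      have habs : |((⌊s' * (n : ℝ)⌋ - ⌊s * (n : ℝ)⌋ : ℤ) : ℝ)| = ((⌊s' * (n : ℝ)⌋ : ℝ) - ⌊s * (n : ℝ)⌋) := by
        push_cast
        exact abs_of_nonneg (by exact_mod_cast sub_nonneg.2 hfl)
      rw [habs]
      exact h
    · have hfl : ⌊s' * (n : ℝ)⌋ ≤ ⌊s * n⌋ :=
        Int.floor_le_floor (mul_le_mul_of_nonneg_right hss' (Nat.cast_nonneg _))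
      have h := hC a c y x₀ x₁ hεxa hεcx hεyc n hn ⌊s' * n⌋ ⌊s * n⌋
        (Int.floor_le_floor (mul_le_mul_of_nonneg_right h₀' (Nat.cast_nonneg _))) hfl
        (Int.floor_le_floor (mul_le_mul_of_nonneg_right h₁ (Nat.cast_nonneg _)))
      have habs : |((⌊s' * (n : ℝ)⌋ - ⌊s * (n : ℝ)⌋ : ℤ) : ℝ)| = ((⌊s * (n : ℝ)⌋ : ℝ) - ⌊s' * (n : ℝ)⌋) := by
        push_cast
        rw [abs_sub_comm]
        exact abs_of_nonneg (by exact_mod_cast sub_nonneg.2 hfl)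
      rw [habs, abs_sub_comm]
      exact h

/-! ### Joint subsequential limits: the inner marks -/

section JointLimit

variable {θ : ℕ → ℕ} {G : ℝ → ℝ → ℝ → ℝ → ℝ}
  (hG : ∀ a b c y : ℝ, a < b → b < c → c < y →
    Tendsto (fun n ↦ μ.real (openCrossing halfPlane (arcA a b (θ n))
      (rowIcc ⌊c * (θ n : ℕ)⌋ ⌊y * (θ n : ℕ)⌋))) atTop (𝓝 (G a b c y)))
include hG

/-- **Joint limits are differentiable in the SECOND mark, with derivative the near-end density
limit.** For a joint subsequential limit `G` along `θ → ∞` and `a < b < c < y`: `s ↦ G a s c y` is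
differentiable at `b`, and `θ j · P[firstHit halfPlane C_{θ j} ⌊a θ j⌋ ⌊b θ j⌋] → ∂₂G(a,b,c,y)`.
[folklore] -/
theorem hasDerivAt_jointLimit_second (hθ : Tendsto θ atTop atTop) {a b c y : ℝ} (hab : a < b)
    (hbc : b < c) (hcy : c < y) :
    HasDerivAt (fun s ↦ G a s c y) (deriv (fun s ↦ G a s c y) b) b ∧
      Tendsto (fun j ↦ (θ j : ℝ) *
        μ.real (firstHit halfPlane (rowIcc ⌊c * (θ j : ℕ)⌋ ⌊y * (θ j : ℕ)⌋) ⌊a * (θ j : ℕ)⌋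
          ⌊b * (θ j : ℕ)⌋)) atTop (𝓝 (deriv (fun s ↦ G a s c y) b)) := by
  -- separation scale `8ε ≤ min (b − a, c − b, y − c)`
  obtain ⟨ε, hε, hεab, hεbc, hεcy⟩ : ∃ ε : ℝ, 0 < ε ∧ 8 * ε ≤ b - a ∧ 8 * ε ≤ c - b ∧ 8 * ε ≤ y - c := by
    refine ⟨min (min (b - a) (c - b)) (y - c) / 8, ?_, ?_, ?_, ?_⟩
    · have : 0 < min (min (b - a) (c - b)) (y - c) :=
        lt_min (lt_min (by linarith) (by linarith)) (by linarith)
      positivity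
    · have : min (min (b - a) (c - b)) (y - c) ≤ b - a := (min_le_left _ _).trans (min_le_left _ _)
      linarith
    · have : min (min (b - a) (c - b)) (y - c) ≤ c - b := (min_le_left _ _).trans (min_le_right _ _)
      linarith
    · have : min (min (b - a) (c - b)) (y - c) ≤ y - c := min_le_right _ _
      linarith
  obtain ⟨C, -, hT⟩ := uniformRegularity_b hε
  obtain ⟨hT', -⟩ := hT a c y (b - ε) (b + ε) (by linarith) (by linarith) (by linarith)
  obtain ⟨ρ, hρ, hD, -, -⟩ := hT' b ε hε le_rfl le_rfl θ hθ (fun s ↦ G a s c y)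
    (fun s'' hs₁ hs₂ ↦ hG a s'' c y (by linarith) (by linarith) hcy)
  rw [hD.deriv]
  exact ⟨hD, hρ⟩

/-- The second-mark derivative of a joint limit is nonnegative. [folklore] -/
theorem deriv_second_nonneg (hθ : Tendsto θ atTop atTop) {a b c y : ℝ} (hab : a < b) (hbc : b < c)
    (hcy : c < y) : 0 ≤ deriv (fun s ↦ G a s c y) b :=
  ge_of_tendsto' (hasDerivAt_jointLimit_second hG hθ hab hbc hcy).2
    fun _ ↦ mul_nonneg (Nat.cast_nonneg _) measureReal_nonneg

/-- Joint limits are differentiable on `(a, c)` in the second mark. [folklore] -/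
theorem differentiableOn_jointLimit_second (hθ : Tendsto θ atTop atTop) {a c y : ℝ} (hcy : c < y) :
    DifferentiableOn ℝ (fun s ↦ G a s c y) (Ioo a c) :=
  fun _ hs ↦ (hasDerivAt_jointLimit_second hG hθ hs.1 hs.2 hcy).1.differentiableAt.differentiableWithinAt

/-- **Joint limits are differentiable in the THIRD mark, by reflection**: for a joint limit along a
strictly increasing `θ` and `a < b < c < y`, `s ↦ G a b s y` is differentiable at `c` with
`∂₃G(a,b,c,y) = −∂₂G(−y,−c,−b,−a) ≤ 0` (`reflect_of_jointLimit`: `G(−y,−s,−b,−a) = G(a,b,s,y)`).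
[folklore] -/
theorem hasDerivAt_jointLimit_third (hθ : StrictMono θ) {a b c y : ℝ} (hab : a < b) (hbc : b < c)
    (hcy : c < y) :
    HasDerivAt (fun s ↦ G a b s y) (-deriv (fun s ↦ G (-y) s (-b) (-a)) (-c)) c := by
  have h := hasDerivAt_jointLimit_second hG hθ.tendsto_atTop (a := -y) (b := -c) (c := -b) (y := -a)
    (by linarith) (by linarith) (by linarith)
  have hcomp : HasDerivAt (fun s ↦ G (-y) (-s) (-b) (-a))
      (deriv (fun s ↦ G (-y) s (-b) (-a)) (-c) * (-1)) c :=
    h.1.comp c (hasDerivAt_neg c)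
  have hev : (fun s ↦ G (-y) (-s) (-b) (-a)) =ᶠ[𝓝 c] fun s ↦ G a b s y := by
    filter_upwards [Ioo_mem_nhds hbc hcy] with s hs
    exact Subseq.reflect_of_jointLimit hG hθ hab hs.1 hs.2
  rw [show -deriv (fun s ↦ G (-y) s (-b) (-a)) (-c) = deriv (fun s ↦ G (-y) s (-b) (-a)) (-c) * (-1)
    by ring]
  exact hcomp.congr_of_eventuallyEq hev.symm

/-- The third-mark derivative of a joint limit is nonpositive. [folklore] -/
theorem deriv_third_nonpos (hθ : StrictMono θ) {a b c y : ℝ} (hab : a < b) (hbc : b < c)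
    (hcy : c < y) : deriv (fun s ↦ G a b s y) c ≤ 0 := by
  rw [(hasDerivAt_jointLimit_third hG hθ hab hbc hcy).deriv, neg_nonpos]
  exact deriv_second_nonneg hG hθ.tendsto_atTop (by linarith) (by linarith) (by linarith)

/-- Joint limits are differentiable on `(b, y)` in the third mark. [folklore] -/
theorem differentiableOn_jointLimit_third (hθ : StrictMono θ) {a b y : ℝ} (hab : a < b) :
    DifferentiableOn ℝ (fun s ↦ G a b s y) (Ioo b y) :=
  fun _ hs ↦ (hasDerivAt_jointLimit_third hG hθ hab hs.1 hs.2).differentiableAt.differentiableWithinAt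

/-- **All four first partial derivatives of a joint subsequential limit exist at every chamber point**
(outer marks: `…DensityIdentification`; inner marks: this file). [folklore] -/
theorem differentiableAt_jointLimit_all (hθ : StrictMono θ) {a b c y : ℝ} (hab : a < b) (hbc : b < c)
    (hcy : c < y) :
    DifferentiableAt ℝ (fun s ↦ G s b c y) a ∧ DifferentiableAt ℝ (fun s ↦ G a s c y) b ∧
      DifferentiableAt ℝ (fun s ↦ G a b s y) c ∧ DifferentiableAt ℝ (fun s ↦ G a b c s) y :=
  ⟨(Density.hasDerivAt_jointLimit_first hG hθ hab hbc hcy).1.differentiableAt,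
    (hasDerivAt_jointLimit_second hG hθ.tendsto_atTop hab hbc hcy).1.differentiableAt,
    (hasDerivAt_jointLimit_third hG hθ hab hbc hcy).differentiableAt,
    (Density.hasDerivAt_jointLimit hG hθ.tendsto_atTop hab hbc hcy).1.differentiableAt⟩

end JointLimit

/-- **Registered extra stub of line `Sketch` (lead c4-0): every joint subsequential limit of the
collinear half-plane crossing function of bond-`ℤ²` has all four first partial derivatives at every
chamber point**, closed form of `differentiableAt_jointLimit_all`. [folklore] -/
theorem stub_innerMarkDerivatives :
    ∀ θ : ℕ → ℕ, StrictMono θ → ∀ G : ℝ → ℝ → ℝ → ℝ → ℝ,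
      (∀ a b c y : ℝ, a < b → b < c → c < y →
        Tendsto (fun n ↦ μ.real (openCrossing halfPlane (arcA a b (θ n))
          (rowIcc ⌊c * (θ n : ℕ)⌋ ⌊y * (θ n : ℕ)⌋))) atTop (𝓝 (G a b c y))) →
      ∀ a b c y : ℝ, a < b → b < c → c < y →
        DifferentiableAt ℝ (fun s ↦ G s b c y) a ∧ DifferentiableAt ℝ (fun s ↦ G a s c y) b ∧
          DifferentiableAt ℝ (fun s ↦ G a b s y) c ∧ DifferentiableAt ℝ (fun s ↦ G a b c s) y :=
  fun _ hθ _ hG _ _ _ _ hab hbc hcy ↦ differentiableAt_jointLimit_all hG hθ hab hbc hcy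

end NearEnd

end Summit.CriticalPhenomena.CardyFormulaZ2.Cruxes.HalfPlaneMarkDensityLaw.SketchLine
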